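import Mathlib
import Summits.ValiantsHypothesis.ValiantsHypothesis.Theorems.NewtonUnitEquationsNewtonTauWeakExactCoverShadow
import Summits.ValiantsHypothesis.ValiantsHypothesis.Theorems.NewtonUnitEquationsNewtonTauWeakThreeCoreExposed
import Summits.ValiantsHypothesis.ValiantsHypothesis.Theorems.NewtonUnitEquationsNewtonTauWeakFourCoreSplitting
import Summits.ValiantsHypothesis.ValiantsHypothesis.Theorems.NewtonUnitEquationsNewtonTauWeakCoreSplitting
import Summits.ValiantsHypothesis.ValiantsHypothesis.Theorems.NewtonUnitEquationsNewtonTauWeakFourCoreChartRel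

/-!
# Core splitting corollaries (lead c7, line `binomial-normal-form`, crux `NewtonTauWeak`)

Compositions of the landed calibration stubs P5–P10 of the sign-design kill family (card
`Cruxes/NewtonTauWeak/Lines/binomial-normal-form-c7.md` §3b, §9):

* `threeCore_vs_T2` — the open stub T2 with exponent `b` forces `3^x ≤ (2^{x+3}·3·2^x + 2)^b`
  (three-core family, P5 `stub_threeCoreExposed`, through `exactCoverShadow_of_T2`);
* `fourCoreExposed_le` — four cores have at most `2·3^x` strictly positively exposed points (P6);
* `eightCoreChart_le` — a design on `4 + 4` cores has `N₈ + 2^x + 2·3^x ≤ 4·4^x` lower-hull vertices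
  (P7 `stub_coreSplitting` + P10 `stub_fourCoreChartRel` + the arithmetic `sum_slice_bound`):
  the `k = 3` case of `f(2^k) ≤ k + 1` (Minkowski splitting theorem, card §9.1).
-/

-- Sub = Summit single-conjunct layout: the duplicated namespace component is mandated by the tree.
set_option linter.dupNamespace false

open scoped BigOperators
open MvPolynomial
open Summit.ValiantsHypothesis.ValiantsHypothesis.Theorems.NewtonTauWeak.Negative (vert)

namespace Summit.ValiantsHypothesis.ValiantsHypothesis.Theorems.NewtonUnitEquationsNewtonTauWeak

/-- **Calibration of the transfer (PROVED; P5):** `T2(b)` forces `3^x ≤ (2^{x+3}·(3·2^x) + 2)^b` — the three-core family realises base `3`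
per attached element inside an allowance of base `4^b`. -/
theorem threeCore_vs_T2 (b : ℕ)
    (hT2 : ∀ (K N : ℕ) (c : Fin K → ℂ) (ρ : Fin K → Fin N → ℂ) (d : Fin N → (Fin 2 →₀ ℕ)),
      vert (∑ l, C (c l) * ∏ j, (1 - C (ρ l j) * monomial (d j) 1)) ≤ (K * N + 2) ^ b) (x : ℕ) :
    3 ^ x ≤ (2 ^ (x + 3) * (3 * 2 ^ x) + 2) ^ b := by
  obtain ⟨g, ε, h⟩ := stub_threeCoreExposed x
  exact h.trans (exactCoverShadow_of_T2 b hT2 (3 * 2 ^ x) (x + 3) g ε)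

/-- **Four cores give base three (PROVED; P6).**  The strictly positively exposed points of any four-core design number at most
`2·3^x` (P6 without the `2^x` correction); with P5 (`3^x` exposed points for three cores, a sub-design of four cores with the fourth
core's nonempty blocks priced out) the per-element base of the four-core family is exactly `3`. -/
theorem fourCoreExposed_le (x : ℕ) (h : Fin 4 → Finset (Fin x) → (Fin 2 →₀ ℕ)) :
    {q : Fin 2 →₀ ℕ | ∃ f : Fin x → Fin 4, ∑ d, h d (Finset.univ.filter fun u => f u = d) = q ∧
        ∃ w : Fin 2 → ℝ, 0 < w 0 ∧ 0 < w 1 ∧ ∀ f' : Fin x → Fin 4,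
          ∑ d, h d (Finset.univ.filter fun u => f' u = d) ≠ q →
          w 0 * ((q 0 : ℕ) : ℝ) + w 1 * ((q 1 : ℕ) : ℝ) <
            w 0 * (((∑ d, h d (Finset.univ.filter fun u => f' u = d)) 0 : ℕ) : ℝ) +
              w 1 * (((∑ d, h d (Finset.univ.filter fun u => f' u = d)) 1 : ℕ) : ℝ)}.ncard ≤ 2 * 3 ^ x :=
  le_trans (Nat.le_add_right _ _) (stub_fourCoreSplitting x h)

/-- Arithmetic of the `4 + 4` composition: pointwise slice bounds sum to `Σ_W (A W + B W) + 2·3^x ≤ 4·4^x`. -/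
theorem sum_slice_bound (x : ℕ) (A B : Finset (Fin x) → ℕ)
    (hA : ∀ W, A W + 2 ^ (x - W.card) ≤ 2 * 3 ^ (x - W.card))
    (hB : ∀ W, B W + 2 ^ W.card ≤ 2 * 3 ^ W.card) :
    ∑ W : Finset (Fin x), (A W + B W) + 2 * 3 ^ x ≤ 4 * 4 ^ x := by
  have e1 : ∑ W : Finset (Fin x), (2 : ℕ) ^ (x - W.card) = 3 ^ x := by
    simpa [add_comm] using Fin.sum_pow_mul_eq_add_pow (1 : ℕ) 2 (n := x)
  have e2 : ∑ W : Finset (Fin x), (2 : ℕ) ^ W.card = 3 ^ x := by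
    simpa using Fin.sum_pow_mul_eq_add_pow (2 : ℕ) 1 (n := x)
  have e3 : ∑ W : Finset (Fin x), (3 : ℕ) ^ (x - W.card) = 4 ^ x := by
    simpa [add_comm] using Fin.sum_pow_mul_eq_add_pow (1 : ℕ) 3 (n := x)
  have e4 : ∑ W : Finset (Fin x), (3 : ℕ) ^ W.card = 4 ^ x := by
    simpa using Fin.sum_pow_mul_eq_add_pow (3 : ℕ) 1 (n := x)
  have key : ∀ W ∈ (Finset.univ : Finset (Finset (Fin x))),
      (A W + B W) + ((2 : ℕ) ^ (x - W.card) + 2 ^ W.card) ≤ 2 * 3 ^ (x - W.card) + 2 * 3 ^ W.card := by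
    intro W _
    have h₁ := hA W
    have h₂ := hB W
    omega
  have hs := Finset.sum_le_sum key
  have er : ∑ W : Finset (Fin x), (2 * (3 : ℕ) ^ (x - W.card) + 2 * 3 ^ W.card) = 2 * 4 ^ x + 2 * 4 ^ x := by
    rw [Finset.sum_add_distrib, ← Finset.mul_sum, ← Finset.mul_sum, e3, e4]
  have ec : ∑ W : Finset (Fin x), ((2 : ℕ) ^ (x - W.card) + 2 ^ W.card) = 3 ^ x + 3 ^ x := by
    rw [Finset.sum_add_distrib, e1, e2]
  rw [Finset.sum_add_distrib, ec, er] at hs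
  omega

/-- **Eight cores have base at most four (PROVED; P7 + P10).**  For a design on `4 + 4` cores the lower-hull vertices of the cloud satisfy
`N₈ + 2^x + 2·3^x ≤ 4·4^x`: P7 `stub_coreSplitting` at `a = b = 4`, then P10 on both sub-designs of every slice, then `sum_slice_bound`.
This is `f(8) ≤ 4`, the `k = 3` instance of `f(2^k) ≤ k + 1` (card §9.1). -/
theorem eightCoreChart_le (x : ℕ) (h : Fin (4 + 4) → Finset (Fin x) → (Fin 2 →₀ ℕ)) :
    {p : Fin 2 →₀ ℕ | p ∈ (Finset.univ.image fun f : Fin x → Fin (4 + 4) =>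
          ∑ d, h d (Finset.univ.filter fun u => f u = d)) ∧
        ∃ t : ℝ, ∀ q ∈ (Finset.univ.image fun f : Fin x → Fin (4 + 4) =>
          ∑ d, h d (Finset.univ.filter fun u => f u = d)), q ≠ p →
          t * ((q 0 : ℕ) : ℝ) + (-1) * ((q 1 : ℕ) : ℝ) < t * ((p 0 : ℕ) : ℝ) + (-1) * ((p 1 : ℕ) : ℝ)}.ncard +
        2 ^ x + 2 * 3 ^ x ≤ 4 * 4 ^ x := by
  classical
  have h7 := stub_coreSplitting 4 4 x (by norm_num) (by norm_num) h
  have hA : ∀ W : Finset (Fin x),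
      {p : Fin 2 →₀ ℕ | p ∈ (Finset.univ.image fun φ : Fin x → Fin 4 =>
          ∑ d, h (Fin.castAdd 4 d) (Wᶜ ∩ Finset.univ.filter fun u => φ u = d)) ∧
        ∃ t : ℝ, ∀ q ∈ (Finset.univ.image fun φ : Fin x → Fin 4 =>
          ∑ d, h (Fin.castAdd 4 d) (Wᶜ ∩ Finset.univ.filter fun u => φ u = d)), q ≠ p →
          t * ((q 0 : ℕ) : ℝ) + (-1) * ((q 1 : ℕ) : ℝ) < t * ((p 0 : ℕ) : ℝ) + (-1) * ((p 1 : ℕ) : ℝ)}.ncard +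
        2 ^ (x - W.card) ≤ 2 * 3 ^ (x - W.card) := by
    intro W
    simpa only [Finset.card_compl, Fintype.card_fin] using
      (stub_fourCoreChartRel x Wᶜ (fun d => h (Fin.castAdd 4 d)))
  have hB : ∀ W : Finset (Fin x),
      {p : Fin 2 →₀ ℕ | p ∈ (Finset.univ.image fun ψ : Fin x → Fin 4 =>
          ∑ d, h (Fin.natAdd 4 d) (W ∩ Finset.univ.filter fun u => ψ u = d)) ∧
        ∃ t : ℝ, ∀ q ∈ (Finset.univ.image fun ψ : Fin x → Fin 4 =>
          ∑ d, h (Fin.natAdd 4 d) (W ∩ Finset.univ.filter fun u => ψ u = d)), q ≠ p →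
          t * ((q 0 : ℕ) : ℝ) + (-1) * ((q 1 : ℕ) : ℝ) < t * ((p 0 : ℕ) : ℝ) + (-1) * ((p 1 : ℕ) : ℝ)}.ncard +
        2 ^ W.card ≤ 2 * 3 ^ W.card := fun W =>
    stub_fourCoreChartRel x W (fun d => h (Fin.natAdd 4 d))
  have hs := sum_slice_bound x _ _ hA hB
  exact le_trans (Nat.add_le_add_right h7 _) hs

end Summit.ValiantsHypothesis.ValiantsHypothesis.Theorems.NewtonUnitEquationsNewtonTauWeak
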